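import Summits.NavierStokesRegularity.FluidComputer.SwirlBarrierProfile
import Literature.Analysis.FluidPDE.RadialCalculus
import Literature.Analysis.FluidPDE.AxisymPoloidalPart
import HarnessLib

/-!
# The swirl barrier in space and time: derivatives, Laplacian, boundary values, axis geometry

Cell `ns-blowup`, seat `ns-blowup-ecbridge-2` (g13). Proof file (NO definitions, no named facts,
no `sorry`). The comparison function of `SwirlTypeIBarrier.lean` is
`Φ(t, x) = G_{μ(t)}(|x − c|²)`, `G_μ(σ) = K Ψ_a(μ√σ) + Aμ²σ`, `Ψ_a(s) = (1 − e^{−as})/a`,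
`μ(t) = 1/√(T − t)`, centred at a point `c` of the symmetry axis (everything written out
explicitly). This file provides the calculus the weak maximum principle consumes:

* the similarity scale `μ(t) = (√(T − t))⁻¹`: positivity, monotonicity, `dμ/dt = μ³/2`
  (`hasDerivAt_invSqrtGap`), `1 ≤ (T − t₀)^{3/2}μ(t)³` (`one_le_gap_mul_invSqrtGap_pow`);
* the time derivative of `Φ` at fixed `x` (`hasDerivAt_swirlBarrier_time`:
  `∂ₜΦ = K e^{−aμρ}ρμ³/2 + Aμ⁴ρ²`, `ρ = |x − c|`);
* translated radial calculus for ANY profile `g`: `∇[g(|· − c|²)](x) = 2g'⟪x − c, ·⟫`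
  (`hasFDerivAt_comp_norm_sub_sq`) and `Δ[g(|· − c|²)](x) = 4g''ρ² + 2·dim·g'`
  (`laplacian_comp_norm_sub_sq`, the tree's `laplacian_comp_norm_sq` transported by
  `iteratedFDeriv_comp_sub`); smoothness of `G_μ` off `σ = 0` and of `Φ` off the centre
  (`contDiffAt_swirlBarrierSq`, `contDiffAt_swirlBarrier`); continuity of `Φ` below `T`
  (`continuousOn_swirlBarrier_gap`); the boundary lower bounds `swirlBarrier_sq_lower`;
* axis geometry: for `c` on the axis `⟪x − c, e_r(x)⟫ = r(x)` (`inner_sub_axisPoint_eR` — the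
  identity by which the singular drift `(2ν/r)∂ᵣ` of the swirl operator cancels the spherical part
  of `ΔΦ`), `r(x) ≤ |x − c|`, `⟪x − c, v⟫ = ⟪x − c, v̄⟫` (`v̄ = poloidalPart v`), the foot
  `(0, 0, x₂)` of `x` on the axis (`|x − foot| = r(x)`).

WHAT THIS IS NOT: not Navier–Stokes evidence — calculus for a comparison lemma (consumer
`ClayBlowupLocalMeridionalTypeI.lean`). References: Koch–Nadirashvili–Seregin–Šverák 2009, §1
(1.5), (1.8) [cite: KochNadirashviliSereginSverak2009, §1 (1.5)]; the radial Laplacian as in the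
tree's `RadialCalculus.lean` [cite: Lieberman1996, Ch. II Lemma 2.1].
-/

noncomputable section

open MeasureTheory Set Function Filter Topology Metric InnerProductSpace WithLp
open scoped RealInnerProductSpace Laplacian ContDiff NNReal
open Literature.Analysis Literature.Analysis.FluidPDE

namespace Summit.NavierStokesRegularity.FluidComputer

/-! ### The similarity scale `μ(t) = 1/√(T − t)` -/

section Scale

/-- `μ(t) > 0` for `t < T`. [folklore] -/
theorem invSqrtGap_pos {T t : ℝ} (ht : t < T) : 0 < (Real.sqrt (T - t))⁻¹ :=
  inv_pos.2 (Real.sqrt_pos.2 (by linarith))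

/-- `μ` is non-decreasing on `(-∞, T)`. [folklore] -/
theorem invSqrtGap_mono {T t t' : ℝ} (htt' : t ≤ t') (ht' : t' < T) :
    (Real.sqrt (T - t))⁻¹ ≤ (Real.sqrt (T - t'))⁻¹ := by
  have h1 : 0 < Real.sqrt (T - t') := Real.sqrt_pos.2 (by linarith)
  exact inv_anti₀ h1 (Real.sqrt_le_sqrt (by linarith))

/-- `dμ/dt = μ³/2` for `t < T`. [folklore] -/
theorem hasDerivAt_invSqrtGap {T t : ℝ} (ht : t < T) :
    HasDerivAt (fun s : ℝ => (Real.sqrt (T - s))⁻¹) ((Real.sqrt (T - t))⁻¹ ^ 3 / 2) t := by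
  have hgap : 0 < T - t := by linarith
  have hsq : 0 < Real.sqrt (T - t) := Real.sqrt_pos.2 hgap
  have h1 : HasDerivAt (fun s : ℝ => T - s) (-1) t := by
    have h := (hasDerivAt_id t).const_sub T
    simpa only [id, Pi.sub_apply] using h
  have h2 := (h1.sqrt hgap.ne').inv hsq.ne'
  have e : -(-1 / (2 * Real.sqrt (T - t))) / Real.sqrt (T - t) ^ 2 =
      (Real.sqrt (T - t))⁻¹ ^ 3 / 2 := by
    field_simp
  rw [e] at h2
  exact h2

/-- `1 ≤ (T − t₀)^{3/2} μ(t)³` for `t₀ ≤ t < T`. [folklore] -/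
theorem one_le_gap_mul_invSqrtGap_pow {T t₀ t : ℝ} (ht₀ : t₀ ≤ t) (ht : t < T) :
    1 ≤ (T - t₀) * Real.sqrt (T - t₀) * (Real.sqrt (T - t))⁻¹ ^ 3 := by
  set D : ℝ := T - t₀ with hD
  have hD0 : 0 < D := by rw [hD]; linarith
  have hsD : 0 < Real.sqrt D := Real.sqrt_pos.2 hD0
  have h1 : (Real.sqrt D)⁻¹ ≤ (Real.sqrt (T - t))⁻¹ := invSqrtGap_mono ht₀ ht
  have h2 : D * Real.sqrt D * (Real.sqrt D)⁻¹ ^ 3 = 1 := by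
    have hDD : Real.sqrt D ^ 2 = D := Real.sq_sqrt hD0.le
    calc D * Real.sqrt D * (Real.sqrt D)⁻¹ ^ 3
        = Real.sqrt D ^ 2 * Real.sqrt D * (Real.sqrt D)⁻¹ ^ 3 := by rw [hDD]
      _ = 1 := by field_simp
  have h3 : (Real.sqrt D)⁻¹ ^ 3 ≤ (Real.sqrt (T - t))⁻¹ ^ 3 :=
    pow_le_pow_left₀ (by positivity) h1 3
  calc (1 : ℝ) = D * Real.sqrt D * (Real.sqrt D)⁻¹ ^ 3 := h2.symm
    _ ≤ D * Real.sqrt D * (Real.sqrt (T - t))⁻¹ ^ 3 := mul_le_mul_of_nonneg_left h3 (by positivity)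

/-- **Time derivative of the barrier at fixed `ρ ≥ 0`**:
`∂ₜ [K Ψ_a(μρ) + A μ²ρ²] = K e^{−aμρ} ρ μ³/2 + A μ⁴ ρ²`, `μ = μ(t)` (the slice written through
`σ = ρ²`, `√σ = ρ`). [folklore] -/
theorem hasDerivAt_swirlBarrier_time {K A a T t ρ : ℝ} (ha : a ≠ 0) (ht : t < T) (hρ : 0 ≤ ρ) :
    HasDerivAt
      (fun s : ℝ => K * ((1 - Real.exp (-(a * ((Real.sqrt (T - s))⁻¹ * Real.sqrt (ρ ^ 2))))) / a) +
        A * (Real.sqrt (T - s))⁻¹ ^ 2 * ρ ^ 2)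
      (K * Real.exp (-(a * ((Real.sqrt (T - t))⁻¹ * ρ))) * ρ * (Real.sqrt (T - t))⁻¹ ^ 3 / 2 +
        A * (Real.sqrt (T - t))⁻¹ ^ 4 * ρ ^ 2) t := by
  have hμ := hasDerivAt_invSqrtGap ht
  have hrt : Real.sqrt (ρ ^ 2) = ρ := Real.sqrt_sq hρ
  set μ : ℝ := (Real.sqrt (T - t))⁻¹ with hμdef
  have h1 : HasDerivAt (fun s : ℝ => (Real.sqrt (T - s))⁻¹ * ρ) (μ ^ 3 / 2 * ρ) t := hμ.mul_const ρ
  have h2 := ((hasDerivAt_swirlProfile ha (μ * ρ)).comp t h1).const_mul K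
  have h3 : HasDerivAt (fun s : ℝ => A * (Real.sqrt (T - s))⁻¹ ^ 2 * ρ ^ 2)
      (A * (2 * μ * (μ ^ 3 / 2)) * ρ ^ 2) t := by
    have := (hμ.pow 2).const_mul A |>.mul_const (ρ ^ 2)
    simpa using this
  have h := h2.add h3
  refine (h.congr_of_eventuallyEq (Eventually.of_forall fun s => ?_)).congr_deriv ?_
  · simp only [hrt, Function.comp_apply, Pi.add_apply]
  · ring

end Scale

/-! ### Translated radial calculus and the barrier slice in space -/

section Space

/-- **First derivative of a translated radial function**: if `g' (|x − c|²) = g₁` then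
`∇[y ↦ g(|y − c|²)](x) = 2 g₁ ⟪x − c, ·⟫` (`hasFDerivAt_comp_norm_sq` at `x − c`). [folklore] -/
theorem hasFDerivAt_comp_norm_sub_sq {g : ℝ → ℝ} {g₁ : ℝ} {c x : (EuclideanSpace ℝ (Fin 3))}
    (hg : HasDerivAt g g₁ (‖x - c‖ ^ 2)) :
    HasFDerivAt (fun y : (EuclideanSpace ℝ (Fin 3)) => g (‖y - c‖ ^ 2)) ((2 * g₁) • (innerSL ℝ (x - c) : (EuclideanSpace ℝ (Fin 3)) →L[ℝ] ℝ)) x := by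
  have h := hasFDerivAt_comp_norm_sq (z := x - c) hg
  have h2 := h.comp x ((hasFDerivAt_id x).sub_const c)
  simpa [Function.comp_def] using h2

/-- **Laplacian of a translated radial function** (dimension `3`): with `g' = g₁` on an open
`U ∋ |x − c|²` and `g₁'(|x − c|²) = g₂`, `Δ[y ↦ g(|y − c|²)](x) = 4 g₂ |x − c|² + 6 g₁(|x − c|²)`
(`laplacian_comp_norm_sq` transported by `iteratedFDeriv_comp_sub`). [folklore] -/
theorem laplacian_comp_norm_sub_sq {g g₁ : ℝ → ℝ} {g₂ : ℝ} {U : Set ℝ} (hU : IsOpen U)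
    (hg : ∀ σ ∈ U, HasDerivAt g (g₁ σ) σ) {c x : (EuclideanSpace ℝ (Fin 3))} (hx : ‖x - c‖ ^ 2 ∈ U)
    (hg₁ : HasDerivAt g₁ g₂ (‖x - c‖ ^ 2)) :
    (Δ (fun y : (EuclideanSpace ℝ (Fin 3)) => g (‖y - c‖ ^ 2))) x = 4 * g₂ * ‖x - c‖ ^ 2 + 6 * g₁ (‖x - c‖ ^ 2) := by
  have h := laplacian_comp_norm_sq (E := (EuclideanSpace ℝ (Fin 3))) hU hg (z := x - c) hx hg₁
  have htr : (Δ (fun y : (EuclideanSpace ℝ (Fin 3)) => g (‖y - c‖ ^ 2))) x = (Δ (fun w : (EuclideanSpace ℝ (Fin 3)) => g (‖w‖ ^ 2))) (x - c) := by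
    rw [laplacian_eq_iteratedFDeriv_stdOrthonormalBasis,
      laplacian_eq_iteratedFDeriv_stdOrthonormalBasis]
    refine Finset.sum_congr rfl fun i _ => ?_
    rw [iteratedFDeriv_comp_sub (f := fun w : (EuclideanSpace ℝ (Fin 3)) => g (‖w‖ ^ 2)) 2 c x]
  rw [htr, h, finrank_euclideanSpace, Fintype.card_fin]
  push_cast
  ring

/-- The barrier slice `G_μ(σ) = K Ψ_a(μ√σ) + Aμ²σ` is `C^n` at every `σ ≠ 0`. [folklore] -/
theorem contDiffAt_swirlBarrierSq {K A a μ σ : ℝ} (hσ : σ ≠ 0) {n : WithTop ℕ∞} :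
    ContDiffAt ℝ n
      (fun σ : ℝ => K * ((1 - Real.exp (-(a * (μ * Real.sqrt σ)))) / a) + A * μ ^ 2 * σ) σ := by
  have hΨ : ContDiff ℝ n (fun s : ℝ => (1 - Real.exp (-(a * s))) / a) := by fun_prop
  have h1 : ContDiffAt ℝ n (fun σ : ℝ => μ * Real.sqrt σ) σ :=
    contDiffAt_const.mul (Real.contDiffAt_sqrt hσ)
  have h2 : ContDiffAt ℝ n (fun σ : ℝ => (1 - Real.exp (-(a * (μ * Real.sqrt σ)))) / a) σ :=
    hΨ.contDiffAt.comp _ h1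
  exact (contDiffAt_const.mul h2).add (contDiffAt_const.mul contDiffAt_id)

/-- The barrier `x ↦ G_μ(|x − c|²)` is `C^n` off its centre. [folklore] -/
theorem contDiffAt_swirlBarrier {K A a μ : ℝ} {c x : (EuclideanSpace ℝ (Fin 3))} (hx : x ≠ c) {n : WithTop ℕ∞} :
    ContDiffAt ℝ n
      (fun y : (EuclideanSpace ℝ (Fin 3)) => K * ((1 - Real.exp (-(a * (μ * Real.sqrt (‖y - c‖ ^ 2))))) / a) +
        A * μ ^ 2 * ‖y - c‖ ^ 2) x := by
  have hσ : ‖x - c‖ ^ 2 ≠ 0 := by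
    have : 0 < ‖x - c‖ := norm_pos_iff.2 (sub_ne_zero.2 hx)
    positivity
  have hN : ContDiffAt ℝ n (fun y : (EuclideanSpace ℝ (Fin 3)) => ‖y - c‖ ^ 2) x :=
    ((contDiff_norm_sq ℝ).comp (contDiff_id.sub contDiff_const)).contDiffAt
  exact (contDiffAt_swirlBarrierSq (K := K) (A := A) (a := a) (μ := μ) hσ).comp x hN

/-- **Lower bounds for the barrier slice**: for `K, A ≥ 0`, `a > 0`, `0 ≤ μ₀ ≤ μ`, `0 ≤ ρ ≤ ρ₀`:
`K μ₀ ρ e^{−aμ₀ρ₀} ≤ G_μ(ρ²)` and `0 ≤ G_μ(ρ²)` (`Ψ_a` non-decreasing, `s e^{−as} ≤ Ψ_a(s)`). Used on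
the parabolic boundary. [folklore] -/
theorem swirlBarrier_sq_lower {K A a μ₀ μ ρ ρ₀ : ℝ} (hK : 0 ≤ K) (hA : 0 ≤ A) (ha : 0 < a)
    (hμ₀ : 0 ≤ μ₀) (hμ : μ₀ ≤ μ) (hρ : 0 ≤ ρ) (hρρ₀ : ρ ≤ ρ₀) :
    K * (μ₀ * ρ * Real.exp (-(a * (μ₀ * ρ₀)))) ≤
        K * ((1 - Real.exp (-(a * (μ * Real.sqrt (ρ ^ 2))))) / a) + A * μ ^ 2 * ρ ^ 2 ∧
      0 ≤ K * ((1 - Real.exp (-(a * (μ * Real.sqrt (ρ ^ 2))))) / a) + A * μ ^ 2 * ρ ^ 2 := by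
  have hsq : Real.sqrt (ρ ^ 2) = ρ := Real.sqrt_sq hρ
  rw [hsq]
  have hμ' : 0 ≤ μ := hμ₀.trans hμ
  have hΨ0 := swirlProfile_nonneg ha (mul_nonneg hμ' hρ)
  have hquad : 0 ≤ A * μ ^ 2 * ρ ^ 2 := by positivity
  refine ⟨?_, ?_⟩
  · have h2 : μ₀ * ρ * Real.exp (-(a * (μ₀ * ρ))) ≤ (1 - Real.exp (-(a * (μ₀ * ρ)))) / a :=
      mul_exp_le_swirlProfile ha _
    have h3 : (1 - Real.exp (-(a * (μ₀ * ρ)))) / a ≤ (1 - Real.exp (-(a * (μ * ρ)))) / a :=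
      swirlProfile_mono ha (mul_le_mul_of_nonneg_right hμ hρ)
    have h4 : Real.exp (-(a * (μ₀ * ρ₀))) ≤ Real.exp (-(a * (μ₀ * ρ))) := by
      apply Real.exp_le_exp.2
      have : μ₀ * ρ ≤ μ₀ * ρ₀ := mul_le_mul_of_nonneg_left hρρ₀ hμ₀
      nlinarith
    have h5 : μ₀ * ρ * Real.exp (-(a * (μ₀ * ρ₀))) ≤ μ₀ * ρ * Real.exp (-(a * (μ₀ * ρ))) :=
      mul_le_mul_of_nonneg_left h4 (mul_nonneg hμ₀ hρ)
    have h6 := mul_le_mul_of_nonneg_left (h5.trans (h2.trans h3)) hK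
    linarith
  · have := mul_nonneg hK hΨ0
    linarith

/-- The space–time barrier `(t, x) ↦ G_{μ(t)}(|x − c|²)` is continuous below `T`. [folklore] -/
theorem continuousOn_swirlBarrier_gap (K A a T : ℝ) (c : (EuclideanSpace ℝ (Fin 3))) {S : Set ℝ} (hS : ∀ t ∈ S, t < T)
    (Kset : Set (EuclideanSpace ℝ (Fin 3))) :
    ContinuousOn
      (fun p : ℝ × (EuclideanSpace ℝ (Fin 3)) =>
        K * ((1 - Real.exp (-(a * ((Real.sqrt (T - p.1))⁻¹ * Real.sqrt (‖p.2 - c‖ ^ 2))))) / a) +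
          A * (Real.sqrt (T - p.1))⁻¹ ^ 2 * ‖p.2 - c‖ ^ 2)
      (S ×ˢ Kset) := by
  have hΨc : Continuous (fun s : ℝ => (1 - Real.exp (-(a * s))) / a) := by fun_prop
  intro p hp
  have hgap : 0 < T - p.1 := by
    have := hS p.1 (mem_prod.1 hp).1
    linarith
  have hμc : ContinuousAt (fun p : ℝ × (EuclideanSpace ℝ (Fin 3)) => (Real.sqrt (T - p.1))⁻¹) p := by
    have h3 : ContinuousAt (fun p : ℝ × (EuclideanSpace ℝ (Fin 3)) => Real.sqrt (T - p.1)) p := by fun_prop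
    exact h3.inv₀ (Real.sqrt_pos.2 hgap).ne'
  have h5 : ContinuousAt (fun p : ℝ × (EuclideanSpace ℝ (Fin 3)) => Real.sqrt (‖p.2 - c‖ ^ 2)) p := by fun_prop
  have h6 : ContinuousAt (fun p : ℝ × (EuclideanSpace ℝ (Fin 3)) => ‖p.2 - c‖ ^ 2) p := by fun_prop
  exact ((continuousAt_const.mul (hΨc.continuousAt.comp (hμc.mul h5))).add
    ((continuousAt_const.mul (hμc.pow 2)).mul h6)).continuousWithinAt

end Space

/-! ### Axis geometry -/

section Axis

/-- For `c` on the axis, `⟪x − c, e_r(x)⟫ = r(x)` (`e_r` is horizontal and `⟪x, e_r(x)⟫ = r`).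
[folklore] -/
theorem inner_sub_axisPoint_eR {c : (EuclideanSpace ℝ (Fin 3))} (hc : cylRadius c = 0) (x : (EuclideanSpace ℝ (Fin 3))) :
    ⟪x - c, eR x⟫ = cylRadius x := by
  obtain ⟨hc0, hc1⟩ := (cylRadius_eq_zero_iff c).1 hc
  by_cases hx : cylRadius x = 0
  · simp [eR, hx]
  · have hr2 : cylRadius x ^ 2 = x 0 ^ 2 + x 1 ^ 2 := cylRadius_sq x
    simp only [eR, PiLp.inner_apply, Fin.sum_univ_three, PiLp.smul_apply, PiLp.sub_apply,
      RCLike.inner_apply, conj_trivial, smul_eq_mul, Matrix.cons_val_zero, Matrix.cons_val_one,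
      Matrix.cons_val_two, Matrix.head_cons, Matrix.tail_cons, hc0, hc1, sub_zero, mul_zero]
    field_simp
    nlinarith [hr2]

/-- For `c` on the axis, `r(x) ≤ |x − c|`. [folklore] -/
theorem cylRadius_le_norm_sub_axisPoint {c : (EuclideanSpace ℝ (Fin 3))} (hc : cylRadius c = 0) (x : (EuclideanSpace ℝ (Fin 3))) :
    cylRadius x ≤ ‖x - c‖ := by
  obtain ⟨hc0, hc1⟩ := (cylRadius_eq_zero_iff c).1 hc
  have h1 : ‖x - c‖ ^ 2 = (x 0 - c 0) ^ 2 + (x 1 - c 1) ^ 2 + (x 2 - c 2) ^ 2 := by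
    rw [EuclideanSpace.norm_eq, Real.sq_sqrt (by positivity), Fin.sum_univ_three]
    simp only [Real.norm_eq_abs, sq_abs, PiLp.sub_apply]
  have h2 : cylRadius x ^ 2 ≤ ‖x - c‖ ^ 2 := by
    rw [h1, cylRadius_sq, hc0, hc1, sub_zero, sub_zero]
    nlinarith [sq_nonneg (x 2 - c 2)]
  exact (pow_le_pow_iff_left₀ (cylRadius_nonneg x) (norm_nonneg _) two_ne_zero).1 h2

/-- For `c` on the axis, `⟪x − c, v(x)⟫ = ⟪x − c, v̄(x)⟫` with `v̄ = poloidalPart v` (the vector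
`x − c` is meridional: `⟪x − c, e_θ(x)⟫ = 0`). [folklore] -/
theorem inner_sub_axisPoint_eq_inner_poloidalPart {c : (EuclideanSpace ℝ (Fin 3))} (hc : cylRadius c = 0)
    (v : (EuclideanSpace ℝ (Fin 3)) → (EuclideanSpace ℝ (Fin 3))) (x : (EuclideanSpace ℝ (Fin 3))) : ⟪x - c, v x⟫ = ⟪x - c, poloidalPart v x⟫ := by
  obtain ⟨hc0, hc1⟩ := (cylRadius_eq_zero_iff c).1 hc
  rw [poloidalPart_eq_sub_smul_rotGen, inner_sub_right, inner_smul_right]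
  have h : ⟪x - c, rotGen x⟫ = 0 := by
    simp only [rotGen, PiLp.inner_apply, Fin.sum_univ_three, PiLp.sub_apply, RCLike.inner_apply,
      conj_trivial, Matrix.cons_val_zero, Matrix.cons_val_one, Matrix.cons_val_two,
      Matrix.head_cons, Matrix.tail_cons, hc0, hc1, sub_zero]
    ring
  rw [h, mul_zero, sub_zero]

/-- The foot `(0, 0, x₂)` of `x` on the axis lies on the axis. [folklore] -/
theorem cylRadius_axisFoot (x : (EuclideanSpace ℝ (Fin 3))) : cylRadius (EuclideanSpace.single (2 : Fin 3) (x 2)) = 0 := by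
  rw [cylRadius_eq_zero_iff]
  simp

/-- `|x − foot(x)| = r(x)`: the distance to the axis is attained at the foot `(0, 0, x₂)`.
[folklore] -/
theorem norm_sub_axisFoot (x : (EuclideanSpace ℝ (Fin 3))) : ‖x - EuclideanSpace.single (2 : Fin 3) (x 2)‖ = cylRadius x := by
  rw [EuclideanSpace.norm_eq, cylRadius, Fin.sum_univ_three]
  simp [Real.norm_eq_abs, sq_abs]

/-- For `x₁` on the axis, `|foot(x) − x₁| ≤ |x − x₁|`. [folklore] -/
theorem norm_axisFoot_sub_le {x₁ : (EuclideanSpace ℝ (Fin 3))} (hx₁ : cylRadius x₁ = 0) (x : (EuclideanSpace ℝ (Fin 3))) :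
    ‖EuclideanSpace.single (2 : Fin 3) (x 2) - x₁‖ ≤ ‖x - x₁‖ := by
  obtain ⟨h0, h1⟩ := (cylRadius_eq_zero_iff x₁).1 hx₁
  rw [EuclideanSpace.norm_eq, EuclideanSpace.norm_eq]
  refine Real.sqrt_le_sqrt ?_
  simp only [Fin.sum_univ_three, Real.norm_eq_abs, sq_abs, PiLp.sub_apply, h0, h1]
  simp
  nlinarith [sq_nonneg (x 0), sq_nonneg (x 1)]

end Axis

end Summit.NavierStokesRegularity.FluidComputer

end
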